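import Summits.ResolutionOfSingularities.ResolutionOfSingularities.Theorems.EquisingularLiftEquisingularLiftNatTowerRoundBDoublePrimeDefs
import HarnessLib

/-!
# T23-A″-S (seed widening) — DOWNSTAIRS DEFS: `InCarrierReachKS` / `ReachTowerBDoublePrimeS` (+ monotonicity `reachTowerBDoublePrimeS_of_reachTowerBDoublePrime`,
# `reachTowerBDoublePrimeS_of_reachTowerBPrime`, forgetful `inCarrierReachK_of_inCarrierReachKS`)

OURS · L1 W4.5(b) · EL♮(3) stmt-ResolutionOfSingularities-20148 (parent EL♮ stmt-…-20038) · counted 0 · AI-written planning vocabulary, weaker than expert review;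
nothing of [Hironaka2017] asserted; NOT a statement of the manuscript. Definitions + pure-logic monotonicity only (no `sorry`, no instance, no notation; standard
axioms). `--kind definition --supports stmt-ResolutionOfSingularities-20148 --as helper`.
PROVENANCE / CUSTODY: the engine word of res-L1-w45b-stub-4 g11 (STATUS 2026-08-28T08:22:44Z (c), «(A″-S)(i) downstairs word») typed INDEPENDENTLY by
res-L1-w45b-lead-1 g12 (`L/res-L1-w45b-lead-1/ReachTowerBDoublePrimeSDefs-draft.lean` 76023bf5ef9e41be, as lead-2's drafting hand, desk g20 DEAL 08:46:55Z (2)(i))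
and by stub-4 himself (`L/res-L1-w45b-stub-4/TowerReachS.sig.lean` 31e1ddbd15ebbcc2); the desk's normalised diff (08:52:20Z (2)) found (D1)/(D2) IDENTICAL in both —
so the engine owner's shape veto is met by construction. Text-owner custody of the registered texts stays with res-L1-w45b-lead-2 (desk R22 (c)), who adopts these
names BY NAME at the 31st registration; filed by lead-1 under the desk's default rule (lead-2 on the 30th).

WHAT.
* (D1) `InCarrierReachKS F₂ T₂ Z₂ K₂ S₂ F₉ β₉ T₉ Z₉ K₉ S₉ b₉` = `InCarrierReachK` (…NatTowerDefs) with a FIFTH closed-set component `S` (the point plane's trace),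
  transported like `T` at BOTH point steps: `S ↦ closure υ₁⁻¹(S ∖ {y})`. Nothing else.
* (D2) `ReachTowerBDoublePrimeS F₁ F₂ υ x T₂ F' β T'` := `ReachTowerBDoublePrime …` ∨ ⟨the same prefix with `InCarrierReachKS`, `S₂ := υ⁻¹{x}`, and the seed
  `R F₁₀ (𝟙 F₁₀) (closure υ'⁻¹(T₉ ∖ Z₉)) (υ'⁻¹Z₉) [closure υ'⁻¹(S₉ ∖ Z₉)] (closure υ'⁻¹(K₉ ∖ Z₉))`⟩ — the DISJUNCTION makes B″ ⊆ B″S trivial (`Or.inl`); the nose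
  side is untouched (no point phase, no plane).
The S-side facts the upstairs S-assembly carries (res-type-027 g18 (S-8) p618350 `Tower.invB_of_invS_curveStep`: `IsClosed S`, `S ⊆ closure (S ∖ Z)`, `¬ T ⊆ S`,
`IsRegularLocalRing 𝒪_{F₁,x}`) are DERIVED along the chain in the assembly's motive (as the `K` side facts are) and are NOT recorded here — per the word «nothing else».
First customer (by hand, candidate, counted 0): x⁶ + y⁸ + z⁸ runs P · carrier · pair-round · pair-round inside `ReachTowerBDoublePrimeS` with the seeded plane as the
witness of both rounds (res-L1-w45b-lead-1 `ND-SPECIMEN-PASS-3.md` 1a3f9a7943f739b5); x⁴ + y⁶ + z⁶ needs one pair round (`ND-SPECIMEN-PASS-2.md` bd97ffa6ab4d5bd9).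
-/

set_option linter.dupNamespace false

noncomputable section

open CategoryTheory AlgebraicGeometry TopologicalSpace
open Literature.AlgebraicGeometry.Resolution (IsBlowup stalkIdeal)

namespace Summit.ResolutionOfSingularities.ResolutionOfSingularities.Cruxes.EquisingularLiftNat.Sections

/-- **(D1) TOWER / in-carrier point closure carrying the cone shadow AND the point plane** — `InCarrierReachK` with a fifth closed-set component
`S ↦ closure υ₁⁻¹(S ∖ {y})` at both point steps (regular point anywhere; one non-regular point while the flag is down). Downstairs only.
[OURS · T23-A″-S Defs] -/
def InCarrierReachKS (F₂ : Scheme.{0}) (T₂ Z₂ K₂ S₂ : Set F₂) (F₉ : Scheme.{0}) (β₉ : F₉ ⟶ F₂) (T₉ Z₉ K₉ S₉ : Set F₉) (b₉ : Bool) : Prop :=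
  ∀ R : (∀ G : Scheme.{0}, (G ⟶ F₂) → Set G → Set G → Set G → Set G → Bool → Prop),
    R F₂ (𝟙 F₂) T₂ Z₂ K₂ S₂ false →
    (∀ (G₁ G₂ : Scheme.{0}) (β : G₁ ⟶ F₂) (T Z K S : Set G₁) (b : Bool) (y : redSub G₁ (closure Z) isClosed_closure) (υ₁ : G₂ ⟶ G₁)
        (hy : IsClosed ({curvePt G₁ Z y} : Set G₁)),
      R G₁ β T Z K S b → curvePt G₁ Z y ∈ T →
      IsRegularLocalRing ((redSub G₁ (closure Z) isClosed_closure).presheaf.stalk y) →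
      IsRegularLocalRing (G₁.presheaf.stalk (curvePt G₁ Z y)) →
      IsBlowup υ₁ (Scheme.IdealSheafData.vanishingIdeal (⟨{curvePt G₁ Z y}, hy⟩ : Closeds G₁)) →
      R G₂ (υ₁ ≫ β) (closure (υ₁ ⁻¹' (T \ {curvePt G₁ Z y}))) (closure (υ₁ ⁻¹' (Z \ {curvePt G₁ Z y})))
        (closure (υ₁ ⁻¹' (K \ {curvePt G₁ Z y}))) (closure (υ₁ ⁻¹' (S \ {curvePt G₁ Z y}))) b) →
    (∀ (G₁ G₂ : Scheme.{0}) (β : G₁ ⟶ F₂) (T Z K S : Set G₁) (y : redSub G₁ (closure Z) isClosed_closure) (υ₁ : G₂ ⟶ G₁)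
        (hy : IsClosed ({curvePt G₁ Z y} : Set G₁)),
      R G₁ β T Z K S false → curvePt G₁ Z y ∈ T →
      ¬ IsRegularLocalRing ((redSub G₁ (closure Z) isClosed_closure).presheaf.stalk y) →
      IsRegularLocalRing (G₁.presheaf.stalk (curvePt G₁ Z y)) →
      IsBlowup υ₁ (Scheme.IdealSheafData.vanishingIdeal (⟨{curvePt G₁ Z y}, hy⟩ : Closeds G₁)) →
      R G₂ (υ₁ ≫ β) (closure (υ₁ ⁻¹' (T \ {curvePt G₁ Z y}))) (closure (υ₁ ⁻¹' (Z \ {curvePt G₁ Z y})))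
        (closure (υ₁ ⁻¹' (K \ {curvePt G₁ Z y}))) (closure (υ₁ ⁻¹' (S \ {curvePt G₁ Z y}))) true) →
    R F₉ β₉ T₉ Z₉ K₉ S₉ b₉

/-- Forgetting the plane: an `InCarrierReachKS` chain is an `InCarrierReachK` chain (pure logic: instantiate the motive ignoring `S`). [OURS · pure logic] -/
theorem inCarrierReachK_of_inCarrierReachKS (F₂ : Scheme.{0}) (T₂ Z₂ K₂ S₂ : Set F₂) (F₉ : Scheme.{0}) (β₉ : F₉ ⟶ F₂)
    (T₉ Z₉ K₉ S₉ : Set F₉) (b₉ : Bool) (h : InCarrierReachKS F₂ T₂ Z₂ K₂ S₂ F₉ β₉ T₉ Z₉ K₉ S₉ b₉) :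
    InCarrierReachK F₂ T₂ Z₂ K₂ F₉ β₉ T₉ Z₉ K₉ b₉ := by
  intro R hbase hreg hsing
  exact h (fun G β T Z K _ b => R G β T Z K b) hbase
    (fun G₁ G₂ β T Z K _ b y υ₁ hy hR hyT h1 h2 h3 => hreg G₁ G₂ β T Z K b y υ₁ hy hR hyT h1 h2 h3)
    (fun G₁ G₂ β T Z K _ y υ₁ hy hR hyT h1 h2 h3 => hsing G₁ G₂ β T Z K y υ₁ hy hR hyT h1 h2 h3)

/-- **(D2) ReachTowerBDoublePrimeS** — `ReachTowerBDoublePrime` OR the same chain shape whose in-carrier point phase CARRIES THE POINT PLANE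
(`InCarrierReachKS`, `S₂ := υ⁻¹{x}`) and whose round phase is SEEDED with the plane's strict transform as a retained member:
`R F₁₀ (𝟙 F₁₀) (closure υ'⁻¹(T₉ ∖ Z₉)) (υ'⁻¹Z₉) [closure υ'⁻¹(S₉ ∖ Z₉)] (closure υ'⁻¹(K₉ ∖ Z₉))`. Downstairs only. [OURS · T23-A″-S Defs] -/
def ReachTowerBDoublePrimeS (F₁ F₂ : Scheme.{0}) (υ : F₂ ⟶ F₁) (x : F₁) (T₂ : Set F₂) (F' : Scheme.{0}) (β : F' ⟶ F₂) (T' : Set F') : Prop :=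
  ReachTowerBDoublePrime F₁ F₂ υ x T₂ F' β T' ∨
  ∃ (W : Set F₁) (K₂ : Set F₂) (F₉ : Scheme.{0}) (β₉ : F₉ ⟶ F₂) (T₉ Z₉ K₉ S₉ : Set F₉) (b₉ : Bool) (hZ₉ : IsClosed Z₉)
    (F₁₀ : Scheme.{0}) (υ' : F₁₀ ⟶ F₉) (γ' : F' ⟶ F₁₀) (E' : Set F') (Es' : List (Set F')) (K' : Set F'),
    x ∈ W ∧ ¬ (υ ⁻¹' {x} ⊆ closure (υ ⁻¹' (W \ {x}))) ∧
    (∃ U : F₁.affineOpens, x ∈ (U : F₁.Opens) ∧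
      ((Scheme.IdealSheafData.vanishingIdeal (⟨closure W, isClosed_closure⟩ : Closeds F₁)).ideal U).IsPrincipal) ∧
    υ ⁻¹' {x} ∩ closure (υ ⁻¹' (W \ {x})) ⊆ T₂ ∧
    (K₂ = ∅ ∨ (ConeForm F₁ x W ∧ K₂ = closure (υ ⁻¹' (W \ {x})))) ∧
    InCarrierReachKS F₂ T₂ (υ ⁻¹' {x} ∩ closure (υ ⁻¹' (W \ {x}))) K₂ (υ ⁻¹' {x}) F₉ β₉ T₉ Z₉ K₉ S₉ b₉ ∧
    Z₉ ⊆ T₉ ∧ ¬ (T₉ ⊆ Z₉) ∧ Z₉.Infinite ∧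
    Set.Finite {z : redSub F₉ Z₉ hZ₉ | ¬ IsRegularLocalRing ((redSub F₉ Z₉ hZ₉).presheaf.stalk z)} ∧
    IsBlowup υ' (Scheme.IdealSheafData.vanishingIdeal (⟨Z₉, hZ₉⟩ : Closeds F₉)) ∧
    (∀ R : (∀ G : Scheme.{0}, (G ⟶ F₁₀) → Set G → Set G → List (Set G) → Set G → Prop),
      R F₁₀ (𝟙 F₁₀) (closure (υ' ⁻¹' (T₉ \ Z₉))) (υ' ⁻¹' Z₉) [closure (υ' ⁻¹' (S₉ \ Z₉))] (closure (υ' ⁻¹' (K₉ \ Z₉))) →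
      TowerPtRegB F₉ F₁₀ υ' R → TowerPtRamB F₉ F₁₀ υ' R → TowerRoundBDoublePrime F₉ F₁₀ υ' Z₉ hZ₉ R → R F' γ' T' E' Es' K') ∧
    β = (γ' ≫ υ') ≫ β₉

/-- **TOWER-B″ ⊆ TOWER-B″S** (`Or.inl`). [OURS · pure logic] -/
theorem reachTowerBDoublePrimeS_of_reachTowerBDoublePrime (F₁ F₂ : Scheme.{0}) (υ : F₂ ⟶ F₁) (x : F₁) (T₂ : Set F₂) (F' : Scheme.{0})
    (β : F' ⟶ F₂) (T' : Set F') (h : ReachTowerBDoublePrime F₁ F₂ υ x T₂ F' β T') : ReachTowerBDoublePrimeS F₁ F₂ υ x T₂ F' β T' :=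
  Or.inl h

/-- **TOWER-B′ ⊆ TOWER-B″S**. [OURS · pure logic] -/
theorem reachTowerBDoublePrimeS_of_reachTowerBPrime (F₁ F₂ : Scheme.{0}) (υ : F₂ ⟶ F₁) (x : F₁) (T₂ : Set F₂) (F' : Scheme.{0})
    (β : F' ⟶ F₂) (T' : Set F') (h : ReachTowerBPrime F₁ F₂ υ x T₂ F' β T') : ReachTowerBDoublePrimeS F₁ F₂ υ x T₂ F' β T' :=
  Or.inl (reachTowerBDoublePrime_of_reachTowerBPrime F₁ F₂ υ x T₂ F' β T' h)

end Summit.ResolutionOfSingularities.ResolutionOfSingularities.Cruxes.EquisingularLiftNat.Sections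

end
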